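import Literature.NumberTheory.EllipticCurves.EichlerShimuraPeriods
import HarnessLib

/-!
# The `r + 1` Hecke neighbours of a cusp, in bottom-row coordinates

Summit `BirchSwinnertonDyer`, route `ManinLocalTwoThree` (cell bsd-f2-manin), cruxes C2 `ManinOddAtFour`
(stmt-BirchSwinnertonDyer-22967) / C3 `ManinPrimeToThreeAtNine` (stmt-BirchSwinnertonDyer-22968).  Third file of the
cusp-symbol layer (MEMO-es §22–§23) toward E-es-30 `BoundaryEisenstein`: for a prime `r`, `g = (a b; c d) ∈ SL₂(ℤ)`
(= `Γ₀(1)`) and a Hecke representative `βᵢ` (`heckeRep r i`), the tree's permutation data at level `1`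
(`heckePerm`, `heckePermElt`, Shimura (8.3.2): `βᵢ g = g'ᵢ β_{σ(i)}` with `g'ᵢ ∈ SL₂(ℤ)`) satisfy, in the bottom-row
relation `R_M((c,d),(c',d')) :⟺ ∃ k, M ∣ c'(d + k c) − d' c` of `Theorems/ManinLocalTwoThreeCuspClasses.lean`
(written inline):

* if `σ(i) = ∞` then the bottom row of `g'ᵢ` is related to `(c, r d)`   (`cuspRel_heckePermElt_of_none`);
* if `σ(i) = j'` then the bottom row of `g'ᵢ` is related to `(r c, d)`   (`cuspRel_heckePermElt_of_some`),

for every `M` prime to `r` (`s r + t M = 1`).  Since `σ` is a bijection of the `r + 1` indices (`heckePermEquiv`) and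
`β_{σ(i)}` fixes `∞`, the `r + 1` points `βᵢ (g∞) = g'ᵢ ∞` consist of ONE point in the `Γ₀(M)`-class of `(c, r d)`
and `r` points in the class of `(r c, d)` — i.e. on `Γ₀(M)`-invariant functions of cusps
`T_r = ρ_r + r ρ_r⁻¹` with `ρ` the action `[(c,d)] ↦ [(c, a d)]` of `(ℤ/M)^×` (MEMO-es §22.3: «`T_r = σ_r + r σ_r⁻¹`»).
The four cases are read off the matrix identity `g'ᵢ β_{σ(i)} = βᵢ g` (`heckePermElt_spec`):
`(i, σ(i)) = (j, ∞)`: `(c', d') = (c, r d)`; `(∞, ∞)`: `(c/r, d)`; `(j, j')`: `(r c, d − j' c)`; `(∞, j')`: `(c, (d − j' c)/r)`.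

Elementary; no definitions; nothing about BSD or Manin's conjecture is proved here.

References: G. Shimura, *Introduction to the arithmetic theory of automorphic functions* (1971) §8.3 p. 237;
F. Diamond, J. Shurman, GTM 228, §5.2 (5.2); cell memo HOME/MEMO-es.md §22.3.
-/

set_option autoImplicit false
set_option linter.dupNamespace false

open scoped MatrixGroups

open CongruenceSubgroup Literature.NumberTheory.EllipticCurves.ModularForms

namespace Summit.BirchSwinnertonDyer.BirchSwinnertonDyer.Theorems.ManinLocalTwoThree

section Neighbours

variable {r : ℕ} (hr : r.Prime) (g : Gamma0 1) (i : HeckeIdx 1 r)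

/-- Bottom row of `g' β_∞ = (a' r, b'; c' r, d')`. [cite: DiamondShurman2005, §5.2 (5.2)] -/
theorem mul_heckeRep_none_apply_one (A : Matrix (Fin 2) (Fin 2) ℤ) :
    (A * heckeRep r none) 1 0 = A 1 0 * r ∧ (A * heckeRep r none) 1 1 = A 1 1 := by
  rw [mul_heckeRep_none]; exact ⟨rfl, rfl⟩

/-- Bottom row of `g' βⱼ = (a', a' j + b' r; c', c' j + d' r)`. [cite: DiamondShurman2005, §5.2 (5.2)] -/
theorem mul_heckeRep_some_apply_one (A : Matrix (Fin 2) (Fin 2) ℤ) (j : ZMod r) :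
    (A * heckeRep r (some j)) 1 0 = A 1 0 ∧ (A * heckeRep r (some j)) 1 1 = A 1 0 * (j.val : ℤ) + A 1 1 * r := by
  rw [mul_heckeRep_some]; exact ⟨rfl, rfl⟩

/-- Bottom row of `β_∞ g = (r a, r b; c, d)`. [cite: DiamondShurman2005, §5.2 (5.2)] -/
theorem heckeRep_none_mul_apply_one (A : Matrix (Fin 2) (Fin 2) ℤ) :
    (heckeRep r none * A) 1 0 = A 1 0 ∧ (heckeRep r none * A) 1 1 = A 1 1 := by
  constructor <;> simp [heckeRep, Matrix.mul_apply, Fin.sum_univ_two]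

/-- Bottom row of `βⱼ g = (a + j c, b + j d; r c, r d)`. [cite: DiamondShurman2005, §5.2 (5.2)] -/
theorem heckeRep_some_mul_apply_one (A : Matrix (Fin 2) (Fin 2) ℤ) (j : ZMod r) :
    (heckeRep r (some j) * A) 1 0 = r * A 1 0 ∧ (heckeRep r (some j) * A) 1 1 = r * A 1 1 := by
  constructor <;> simp [heckeRep, Matrix.mul_apply, Fin.sum_univ_two]

/-- **The neighbour of index `i` with `σ(i) = ∞` lies in the class of `(c, r d)`**: for every `M` (any integer), if
`heckePerm hr g i = ∞` then the bottom row `(c', d')` of `g'ᵢ = heckePermElt hr g i` satisfies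
`∃ k, M ∣ c'(r d + k c) − d' c` — it is `(c, r d)` itself (`i = j`) or `(c/r, d)` (`i = ∞`). [cite: Shimura1971, §8.3 p. 237] -/
theorem cuspRel_heckePermElt_of_none (M : ℤ) (hσ : (heckePerm hr g i).1 = none) :
    ∃ k : ℤ, M ∣ ((heckePermElt hr g i : Gamma0 1) : SL(2, ℤ)) 1 0 * (r * (g : SL(2, ℤ)) 1 1 + k * (g : SL(2, ℤ)) 1 0)
      - ((heckePermElt hr g i : Gamma0 1) : SL(2, ℤ)) 1 1 * (g : SL(2, ℤ)) 1 0 := by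
  have hspec := heckePermElt_spec hr g i
  rw [hσ] at hspec
  set A : Matrix (Fin 2) (Fin 2) ℤ := (((heckePermElt hr g i : Gamma0 1) : SL(2, ℤ)) : Matrix (Fin 2) (Fin 2) ℤ)
    with hA
  set G : Matrix (Fin 2) (Fin 2) ℤ := ((g : SL(2, ℤ)) : Matrix (Fin 2) (Fin 2) ℤ) with hG
  obtain ⟨hl0, hl1⟩ := mul_heckeRep_none_apply_one (r := r) A
  obtain ⟨_ | j, hi⟩ := i
  · -- `i = ∞`: `β_∞ g` has bottom row `(c, d)`, so `r c' = c`, `d' = d`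
    obtain ⟨hr0, hr1⟩ := heckeRep_none_mul_apply_one (r := r) G
    have e0 : A 1 0 * r = G 1 0 := by rw [← hl0, hspec, hr0]
    have e1 : A 1 1 = G 1 1 := by rw [← hl1, hspec, hr1]
    refine ⟨0, 0, ?_⟩
    show A 1 0 * (r * G 1 1 + 0 * G 1 0) - A 1 1 * G 1 0 = M * 0
    rw [← e0, e1]; ring
  · -- `i = j`: `βⱼ g` has bottom row `(r c, r d)`, so `c' = c`, `d' = r d`
    obtain ⟨hr0, hr1⟩ := heckeRep_some_mul_apply_one (r := r) G j
    have hr' : (r : ℤ) ≠ 0 := by exact_mod_cast hr.ne_zero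
    have e0 : A 1 0 = G 1 0 := by
      have h := hl0.symm.trans (by rw [hspec, hr0] : (A * heckeRep r none) 1 0 = r * G 1 0)
      rw [mul_comm] at h
      exact mul_left_cancel₀ hr' h
    have e1 : A 1 1 = r * G 1 1 := by rw [← hl1, hspec, hr1]
    refine ⟨0, 0, ?_⟩
    show A 1 0 * (r * G 1 1 + 0 * G 1 0) - A 1 1 * G 1 0 = M * 0
    rw [e0, e1]; ring

/-- **The neighbours of index `i` with `σ(i) = j'` lie in the class of `(r c, d)`**: for every `M` with `r` invertible
mod `M` (`s r + t M = 1`), if `heckePerm hr g i = j'` then the bottom row `(c', d')` of `g'ᵢ = heckePermElt hr g i`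
satisfies `∃ k, M ∣ c'(d + k r c) − d' r c` — it is `(r c, d − j' c)` (`i = j`) or `(c, (d − j' c)/r)` (`i = ∞`).
[cite: Shimura1971, §8.3 p. 237] -/
theorem cuspRel_heckePermElt_of_some {M s t : ℤ} (hunit : s * r + t * M = 1) (j' : ZMod r)
    (hσ : (heckePerm hr g i).1 = some j') :
    ∃ k : ℤ, M ∣ ((heckePermElt hr g i : Gamma0 1) : SL(2, ℤ)) 1 0 * ((g : SL(2, ℤ)) 1 1 + k * (r * (g : SL(2, ℤ)) 1 0))
      - ((heckePermElt hr g i : Gamma0 1) : SL(2, ℤ)) 1 1 * (r * (g : SL(2, ℤ)) 1 0) := by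
  have hspec := heckePermElt_spec hr g i
  rw [hσ] at hspec
  set A : Matrix (Fin 2) (Fin 2) ℤ := (((heckePermElt hr g i : Gamma0 1) : SL(2, ℤ)) : Matrix (Fin 2) (Fin 2) ℤ)
    with hA
  set G : Matrix (Fin 2) (Fin 2) ℤ := ((g : SL(2, ℤ)) : Matrix (Fin 2) (Fin 2) ℤ) with hG
  obtain ⟨hl0, hl1⟩ := mul_heckeRep_some_apply_one (r := r) A j'
  obtain ⟨_ | j, hi⟩ := i
  · -- `i = ∞`: `β_∞ g` has bottom row `(c, d)`: `c' = c`, `c' j' + r d' = d`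
    obtain ⟨hr0, hr1⟩ := heckeRep_none_mul_apply_one (r := r) G
    have e0 : A 1 0 = G 1 0 := by rw [← hl0, hspec, hr0]
    have e1 : A 1 0 * (j'.val : ℤ) + A 1 1 * r = G 1 1 := by rw [← hl1, hspec, hr1]
    -- bottom row `(c, d')` with `r d' = d − j' c`: related to `(r c, d)` with `k = −j' s`
    refine ⟨-((j'.val : ℤ) * s), G 1 0 * G 1 0 * (j'.val : ℤ) * t, ?_⟩
    show A 1 0 * (G 1 1 + -((j'.val : ℤ) * s) * (r * G 1 0)) - A 1 1 * (r * G 1 0) = _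
    rw [e0] at e1 ⊢
    linear_combination (-(G 1 0)) * e1 - G 1 0 * G 1 0 * (j'.val : ℤ) * hunit
  · -- `i = j`: `βⱼ g` has bottom row `(r c, r d)`: `c' = r c`, `c' j' + r d' = r d`
    obtain ⟨hr0, hr1⟩ := heckeRep_some_mul_apply_one (r := r) G j
    have hr' : (r : ℤ) ≠ 0 := by exact_mod_cast hr.ne_zero
    have e0 : A 1 0 = r * G 1 0 := by rw [← hl0, hspec, hr0]
    have e1' : A 1 0 * (j'.val : ℤ) + A 1 1 * r = r * G 1 1 := by rw [← hl1, hspec, hr1]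
    have e1 : A 1 1 = G 1 1 - (j'.val : ℤ) * G 1 0 := by
      rw [e0] at e1'
      have h : (r : ℤ) * A 1 1 = r * (G 1 1 - (j'.val : ℤ) * G 1 0) := by linear_combination e1'
      exact mul_left_cancel₀ hr' h
    -- bottom row `(r c, d − j' c)`: related to `(r c, d)` with `k = −j' s`
    refine ⟨-((j'.val : ℤ) * s), r * G 1 0 * G 1 0 * (j'.val : ℤ) * t, ?_⟩
    show A 1 0 * (G 1 1 + -((j'.val : ℤ) * s) * (r * G 1 0)) - A 1 1 * (r * G 1 0) = _
    rw [e0, e1]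
    linear_combination (-(r * G 1 0 * G 1 0 * (j'.val : ℤ))) * hunit

include hr in
/-- At level `1` the index `∞` is available for every prime `r` (`r ∤ 1`). [folklore] -/
theorem heckeIdx_one_none_cond : (none : Option (ZMod r)) = none → ¬ r ∣ 1 :=
  fun _ h ↦ (Nat.Prime.one_lt hr).ne' (Nat.dvd_one.mp h)

/-- **Exactly one neighbour has `σ(i) = ∞`**: the index `σ⁻¹(∞)` (`σ = heckePerm hr g` is a bijection of the
`r + 1` indices, `heckePermEquiv`). [cite: Shimura1971, §8.3 p. 237] -/
theorem heckePerm_eq_none_iff [NeZero r] (i' : HeckeIdx 1 r) :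
    (heckePerm hr g i').1 = none ↔ i' = (heckePermEquiv hr g).symm ⟨none, heckeIdx_one_none_cond hr⟩ := by
  rw [Equiv.eq_symm_apply, heckePermEquiv_apply]
  constructor
  · intro h; exact Subtype.ext h
  · intro h; rw [h]

end Neighbours

end Summit.BirchSwinnertonDyer.BirchSwinnertonDyer.Theorems.ManinLocalTwoThree
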